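import Mathlib
import HarnessLib
import Summits.ValiantsHypothesis.ValiantsHypothesis.Theorems.MonotoneRestorationOrbitRestorationQPExplicitToPDClass
import Summits.ValiantsHypothesis.ValiantsHypothesis.Theorems.MonotoneRestorationOrbitRestorationQPSmlAffineRowRestoration

/-!
# The affine set-multilinear class lies inside `PDClass 1`: stub A_∞ HOLDS on it (certified sub-case of the registered stub)
(crux `OrbitRestorationQP`, stmt-ValiantsHypothesis-18293 — line `depth-three-rung`, registered stub `stub_sigmaPiSigmaValue` =
A_∞: `∀ f, IsMatrixSymmetric f → (∃ c, ∀ n, PDClass (fun _ => 1) n c (f n)) → ∃ c, ∀ n, QPOrbitRestorable c n (f n)`)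

An affine column- (or row-) set-multilinear `ΣΠΣ` expression with `s ≤ n^c + c` product gates is explicit depth-three data
(`s` products of `n` affine forms), hence lies in the rung's hypothesis class `PDClass (fun _ => 1) n c₁`
(`ExplicitForm.pdClass_one_of_explicit`, `c₁ = 2(2(c+1)+8) + 3^{2(c+1)+8}`).  With `SmlAffineRestoration.affineSml_restoration`
this certifies the stub ON THE CLASS:

* `pdClassOne_of_affineColSml`, `pdClassOne_of_affineRowSml` — membership in `PDClass 1`;
* `sigmaPiSigmaValue_on_affineSml` — **for every matrix-symmetric family with affine column- or row-sml expressions of at most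
  `n^c + c` product gates: the HYPOTHESIS of `stub_sigmaPiSigmaValue` holds (`∃ c₁, ∀ n, PDClass (fun _ => 1) n c₁ (f n)`) AND
  its CONCLUSION holds (`∃ c', ∀ n, QPOrbitRestorable c' n (f n)`).**

Honest label: a certified sub-case of the conjecture-grade stub; the stub itself (all of `PDClass 1`) is not closed; VP ≠ VNP
untouched. [folklore]
-/

noncomputable section

open scoped Classical

-- `Summit.ValiantsHypothesis.ValiantsHypothesis.…` is the tree's single-conjunct layout (Sub = Summit).
set_option linter.dupNamespace false

namespace Summit.ValiantsHypothesis.ValiantsHypothesis.Theorems.SmlAffineRestoration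

open MvPolynomial Finset Equiv Literature.Computability.AlgebraicComplexity OrbitRestorationQPDepthThreeRung SmlRestoration
  SmlAffineNarrow

/-- Budget bookkeeping: `n^c + c ≤ n^{c+1} + (c+1)` and `n ≤ n^{c+1} + (c+1)`. [folklore] -/
theorem pow_add_le_pow_succ_add (n c : ℕ) : n ^ c + c ≤ n ^ (c + 1) + (c + 1) ∧ n ≤ n ^ (c + 1) + (c + 1) := by
  rcases Nat.eq_zero_or_pos n with rfl | hn
  · rcases Nat.eq_zero_or_pos c with rfl | hc
    · simp
    · rw [zero_pow (by omega), zero_pow (by omega)]; omega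
  · constructor
    · have : n ^ c ≤ n ^ (c + 1) := Nat.pow_le_pow_right hn (by omega)
      omega
    · calc n = n ^ 1 := (pow_one n).symm
        _ ≤ n ^ (c + 1) := Nat.pow_le_pow_right hn (by omega)
        _ ≤ n ^ (c + 1) + (c + 1) := Nat.le_add_right _ _

/-- **An affine column-sml expression with `s ≤ n^c + c` product gates lies in `PDClass 1`.** [folklore] -/
theorem pdClassOne_of_affineColSml {n s c : ℕ} (hs : s ≤ n ^ c + c) (β : Fin s → Fin n → ℂ)
    (α : Fin s → Fin n → Fin n → ℂ) :
    PDClass (fun _ => 1) n (2 * (2 * (c + 1) + 8) + 3 ^ (2 * (c + 1) + 8))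
      (∑ t : Fin s, ∏ b : Fin n, (C (β t b) + ∑ a : Fin n, C (α t b a) * X (a, b)) : MvPolynomial (Fin n × Fin n) ℂ) := by
  obtain ⟨h1, h2⟩ := pow_add_le_pow_succ_add n c
  have h := ExplicitForm.pdClass_one_of_explicit (n := n) (c := c + 1) (𝒯 := Fin s) (by rw [Fintype.card_fin]; omega)
    (fun _ => (1 : ℂ))
    (fun t => (Finset.univ : Finset (Fin n)).val.map fun b =>
      (C (β t b) + ∑ a : Fin n, C (α t b a) * X (a, b) : MvPolynomial (Fin n × Fin n) ℂ))
    (fun t ℓ hℓ => by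
      obtain ⟨b, _, rfl⟩ := Multiset.mem_map.1 hℓ
      exact totalDegree_affineForm_le _ _ _)
    (fun t => by rw [Multiset.card_map, Finset.card_val, Finset.card_univ, Fintype.card_fin]; exact h2)
  have heq : (∑ t : Fin s, C (1 : ℂ) * ((Finset.univ : Finset (Fin n)).val.map fun b =>
      (C (β t b) + ∑ a : Fin n, C (α t b a) * X (a, b) : MvPolynomial (Fin n × Fin n) ℂ)).prod) =
      ∑ t : Fin s, ∏ b : Fin n, (C (β t b) + ∑ a : Fin n, C (α t b a) * X (a, b)) := by
    refine Finset.sum_congr rfl fun t _ => ?_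
    rw [map_one, one_mul, Finset.prod_eq_multiset_prod]
  rwa [heq] at h

/-- **An affine row-sml expression with `s ≤ n^c + c` product gates lies in `PDClass 1`.** [folklore] -/
theorem pdClassOne_of_affineRowSml {n s c : ℕ} (hs : s ≤ n ^ c + c) (β : Fin s → Fin n → ℂ)
    (α : Fin s → Fin n → Fin n → ℂ) :
    PDClass (fun _ => 1) n (2 * (2 * (c + 1) + 8) + 3 ^ (2 * (c + 1) + 8))
      (∑ t : Fin s, ∏ a : Fin n, (C (β t a) + ∑ b : Fin n, C (α t a b) * X (a, b)) : MvPolynomial (Fin n × Fin n) ℂ) := by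
  obtain ⟨h1, h2⟩ := pow_add_le_pow_succ_add n c
  have hdeg : ∀ (t : Fin s) (a : Fin n),
      (C (β t a) + ∑ b : Fin n, C (α t a b) * X (a, b) : MvPolynomial (Fin n × Fin n) ℂ).totalDegree ≤ 1 := by
    intro t a
    refine (totalDegree_add _ _).trans (max_le ?_ ?_)
    · rw [totalDegree_C]; exact Nat.zero_le _
    · refine totalDegree_finsetSum_le fun b _ => (totalDegree_mul _ _).trans ?_
      rw [totalDegree_C, totalDegree_X]
  have h := ExplicitForm.pdClass_one_of_explicit (n := n) (c := c + 1) (𝒯 := Fin s) (by rw [Fintype.card_fin]; omega)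
    (fun _ => (1 : ℂ))
    (fun t => (Finset.univ : Finset (Fin n)).val.map fun a =>
      (C (β t a) + ∑ b : Fin n, C (α t a b) * X (a, b) : MvPolynomial (Fin n × Fin n) ℂ))
    (fun t ℓ hℓ => by
      obtain ⟨a, _, rfl⟩ := Multiset.mem_map.1 hℓ
      exact hdeg t a)
    (fun t => by rw [Multiset.card_map, Finset.card_val, Finset.card_univ, Fintype.card_fin]; exact h2)
  have heq : (∑ t : Fin s, C (1 : ℂ) * ((Finset.univ : Finset (Fin n)).val.map fun a =>
      (C (β t a) + ∑ b : Fin n, C (α t a b) * X (a, b) : MvPolynomial (Fin n × Fin n) ℂ)).prod) =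
      ∑ t : Fin s, ∏ a : Fin n, (C (β t a) + ∑ b : Fin n, C (α t a b) * X (a, b)) := by
    refine Finset.sum_congr rfl fun t _ => ?_
    rw [map_one, one_mul, Finset.prod_eq_multiset_prod]
  rwa [heq] at h

/-- **Stub A_∞ HOLDS ON THE AFFINE SET-MULTILINEAR CLASS**: hypothesis (`PDClass 1` membership) and conclusion
(`QPOrbitRestorable`) of `stub_sigmaPiSigmaValue`, for every matrix-symmetric family with affine column- or row-sml expressions of
at most `n^c + c` product gates. [folklore] -/
theorem sigmaPiSigmaValue_on_affineSml (f : (n : ℕ) → MvPolynomial (Fin n × Fin n) ℂ) (hsym : IsMatrixSymmetric f)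
    (hcirc : ∃ c : ℕ, ∀ n : ℕ, ∃ (s : ℕ) (β : Fin s → Fin n → ℂ) (α : Fin s → Fin n → Fin n → ℂ), s ≤ n ^ c + c ∧
      (f n = ∑ t : Fin s, ∏ b : Fin n, (C (β t b) + ∑ a : Fin n, C (α t b a) * X (a, b)) ∨
       f n = ∑ t : Fin s, ∏ a : Fin n, (C (β t a) + ∑ b : Fin n, C (α t a b) * X (a, b)))) :
    (∃ c₁ : ℕ, ∀ n : ℕ, PDClass (fun _ => 1) n c₁ (f n)) ∧ ∃ c' : ℕ, ∀ n : ℕ, QPOrbitRestorable c' n (f n) := by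
  obtain ⟨c, hc⟩ := hcirc
  refine ⟨⟨2 * (2 * (c + 1) + 8) + 3 ^ (2 * (c + 1) + 8), fun n => ?_⟩, affineSml_restoration f hsym ⟨c, hc⟩⟩
  obtain ⟨s, β, α, hs, hf | hf⟩ := hc n
  · rw [hf]; exact pdClassOne_of_affineColSml hs β α
  · rw [hf]; exact pdClassOne_of_affineRowSml hs β α

end Summit.ValiantsHypothesis.ValiantsHypothesis.Theorems.SmlAffineRestoration

end
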